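import Summits.HubbardSuperconductivity.HubbardSuperconductivity.Theorems.KLProgrammeKLRegimeTwoPointAssemblyMatsubaraRiemannSums
import HarnessLib

/-!
# Child `KLRegimeTwoPointAssemblyV7` of crux K3 (stmt-HubbardSuperconductivity-19666), line `asm-repr` —
# the MATSUBARA–RIEMANN DOUBLE LIMIT, part 2: the double limit and its Cauchy form
# (analytic core of the stub `stub_asm_int`; seat hubbard-kl-k3c5-p1)

Model-free analysis.  For every cutoff pair `(L, M)` let `f L M : FreqMomentum L M → ℂ` be a function on the
`2M` Matsubara frequencies `ω = π(2n+1)/β`, `n ∈ [-M, M)`, times the momentum grid `(2π/L)(ℤ/Lℤ)²` (in the application: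
`e^{ip·(x−y)} ĝ_K(ω,p)² Σ̂_{L,M}((ω,p),σ)`, the summand of `reprInt`).  Assume

* (H1) a summable frequency tail, uniformly in the volume: `‖f L M (ω,q)‖ ≤ C/ω²` for `L ≥ L₀`, `M ≥ M⋆(L)`;
* (H2) grid convergence at each fixed Matsubara integer `n` to a continuous function of the momentum, in the iterated sense
  `∀ ε, ∃ L₁, ∀ L ≥ L₁, ∃ M₁, ∀ M ≥ M₁`: `‖f L M (ω_n, q) − φ_n(p_q)‖ ≤ ε` for all `q` (`p_q = 2πq/L`)
  — exactly the two clauses of the volume-limit slot `FinalTwoLegVolLimit`.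

Then (`matsubaraRiemann_doubleLimit`) the Brillouin-zone integrals `∫ φ_n` are summable over `n ∈ ℤ` and
`(βL²)⁻¹ Σ_{(ω,q)} f L M (ω,q) → (β(2π)²)⁻¹ Σ_n ∫_{[0,2π]²} φ_n` in the same iterated sense; in particular
(`matsubaraRiemann_cauchy`) the normalised sums are Cauchy in the `(L, L′; M, M′)` form of `stub_asm_int`.
Proof: head `|n| ≤ N` by (H2) and Riemann sums of continuous functions (`tendsto_cornerRiemannSum`), tails by (H1) and
`Σ_n ω_n⁻² < ∞`; the bound `|∫ φ_n| ≤ (2π)² C/ω_n²` is read off the Riemann sums themselves.  Everything is PROVED; no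
definition, nothing about the model.

References: G. Benfatto, A. Giuliani, V. Mastropietro, Ann. Henri Poincaré 7 (2006) 809, §2 (finite-volume momentum and
frequency sums → integrals); S. Friedli, Y. Velenik, *Statistical Mechanics of Lattice Systems* (2017) §10.5.2.
-/

noncomputable section

namespace Summit.HubbardSuperconductivity.HubbardSuperconductivity.Theorems.TwoPointAssembly

set_option linter.dupNamespace false -- summit = problem name (single-conjunct summit), D-0017

open Filter Topology Finset MeasureTheory Literature.MathematicalPhysics.QuantumLattice Literature.Probability.LatticeModels

/-! ### §4 The double limit -/

section DoubleLimit

variable {β : ℝ} (f : (L M : ℕ) → FreqMomentum L M → ℂ) (φ : ℤ → (Fin 2 → ℝ) → ℂ) {C : ℝ} {L₀ : ℕ} {Mstar : ℕ → ℕ}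

/-- A finite sum of a nonnegative summable function over integers outside `T` is at most the tail sum `Σ'_{n ∉ T}`. -/
theorem sum_le_tsum_subtype_compl_of_disjoint {h : ℤ → ℝ} (hh : ∀ n, 0 ≤ h n) (hs : Summable h)
    (T J : Finset ℤ) (hJ : ∀ n ∈ J, n ∉ T) :
    ∑ n ∈ J, h n ≤ ∑' n : {m // m ∉ T}, h n := by
  have hdisj : Disjoint J T := Finset.disjoint_left.mpr fun n hn hT => hJ n hn hT
  have h1 : ∑ n ∈ J ∪ T, h n ≤ ∑' n, h n := Summable.sum_le_tsum _ (fun n _ => hh n) hs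
  rw [Finset.sum_union hdisj] at h1
  have h2 := hs.sum_add_tsum_subtype_compl T
  linarith

/-- **The Matsubara–Riemann double limit.**  Let `f L M : FreqMomentum L M → ℂ` satisfy (H1) `‖f L M (ω,q)‖ ≤ C/ω²` for
`L ≥ L₀`, `M ≥ M⋆(L)`, and (H2) for every Matsubara integer `n`, `f L M (ω_n, q)` is eventually (first `L`, then `M`)
uniformly within any `ε` of `φ_n(p_q)`, `φ_n` continuous.  Then the Brillouin integrals `∫_{[-π,π]²} φ_n(p+π) dp` are summable
over `n ∈ ℤ`, and with `S = (Σ'_n ∫ φ_n(·+π)) / (β(2π)²)`: for every `ε > 0` there is `L₁` such that for every `L ≥ L₁`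
there is `M₁` with `‖(βL²)⁻¹ Σ_{(ω,q)} f L M (ω,q) − S‖ ≤ ε` for all `M ≥ M₁`. -/
theorem matsubaraRiemann_doubleLimit (hβ : 0 < β) (hφ : ∀ n, Continuous (φ n))
    (hdom : ∀ (L : ℕ) [NeZero L], L₀ ≤ L → ∀ M : ℕ, Mstar L ≤ M → ∀ k : FreqMomentum L M,
      ‖f L M k‖ ≤ C / (matsubaraFreq β M k.1) ^ 2)
    (hconv : ∀ (n : ℤ) (ε : ℝ), 0 < ε → ∃ L₁ : ℕ, ∀ (L : ℕ) [NeZero L], L₁ ≤ L → ∃ M₁ : ℕ, ∀ M : ℕ, M₁ ≤ M →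
      ∀ k : FreqMomentum L M, matsubaraInt M k.1 = n → ‖f L M k - φ n (latticeMomentum L k.2)‖ ≤ ε) :
    Summable (fun n : ℤ => ∫ p in brillouin 2, φ n (p + fun _ => Real.pi)) ∧
    ∀ ε : ℝ, 0 < ε → ∃ L₁ : ℕ, ∀ (L : ℕ) [NeZero L], L₁ ≤ L → ∃ M₁ : ℕ, ∀ M : ℕ, M₁ ≤ M →
      ‖(∑ k : FreqMomentum L M, f L M k) / ((β * (L : ℝ) ^ 2 : ℝ) : ℂ) -
        (∑' n : ℤ, ∫ p in brillouin 2, φ n (p + fun _ => Real.pi)) / ((β * (2 * Real.pi) ^ 2 : ℝ) : ℂ)‖ ≤ ε := by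
  classical
  have hIsum := summable_integral_brillouin_of_grid f φ hφ hdom hconv
  refine ⟨hIsum, fun ε hε => ?_⟩
  -- notation
  set I : ℤ → ℂ := fun n => ∫ p in brillouin 2, φ n (p + fun _ => Real.pi) with hI
  set ω : ℤ → ℝ := fun n => Real.pi * (2 * (n : ℝ) + 1) / β with hω
  have hω0 : ∀ n, ω n ≠ 0 := by
    intro n
    have h1 : (2 * (n : ℝ) + 1) ≠ 0 := by
      intro h
      have : (2 * n + 1 : ℤ) = 0 := by exact_mod_cast h
      omega
    simp only [hω]
    exact div_ne_zero (mul_ne_zero Real.pi_ne_zero h1) hβ.ne'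
  have hω2 : ∀ n, 0 < ω n ^ 2 := fun n => by
    have := hω0 n
    positivity
  -- `C ≥ 0` (the domain is nonempty)
  have hC : 0 ≤ C := by
    set L : ℕ := max L₀ 1 with hL
    haveI : NeZero L := ⟨by omega⟩
    set M : ℕ := max (Mstar L) 1 with hM
    have hM2 : 0 < 2 * M := by omega
    have h := hdom L (le_max_left _ _) M (le_max_left _ _) (⟨0, hM2⟩, fun _ => 0)
    have h0 : 0 ≤ C / (matsubaraFreq β M ⟨0, hM2⟩) ^ 2 := (norm_nonneg _).trans h
    have hpos : 0 < (matsubaraFreq β M ⟨0, hM2⟩) ^ 2 := by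
      rw [matsubaraFreq_eq_of_matsubaraInt_eq rfl]; exact hω2 _
    exact (div_nonneg_iff.mp h0).elim (fun h => h.1) fun h => absurd h.2 (not_le.mpr hpos)
  set h : ℤ → ℝ := fun n => C / ω n ^ 2 with hh
  have hh0 : ∀ n, 0 ≤ h n := fun n => div_nonneg hC (hω2 n).le
  have hhsum : Summable h := by
    have : h = fun n : ℤ => C * β ^ 2 / Real.pi ^ 2 * (1 / (2 * (n : ℝ) + 1) ^ 2) := by
      funext n; simp only [hh, hω]; exact div_omega_sq_eq β C n
    rw [this]
    exact summable_one_div_two_mul_add_one_sq.mul_left _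
  have hIle : ∀ n, ‖I n‖ ≤ (2 * Real.pi) ^ 2 * h n := fun n =>
    norm_integral_brillouin_le_of_grid f φ hφ hdom hconv n
  -- the tail set `T`
  set δ : ℝ := ε * β / 4 with hδ
  have hδpos : 0 < δ := by positivity
  have htail := tendsto_tsum_compl_atTop_zero h
  obtain ⟨T, hT⟩ := (htail.eventually (gt_mem_nhds hδpos)).exists
  -- the head tolerance `η`
  set η : ℝ := ε * β / (4 * ((T.card : ℝ) + 1)) with hη
  have hηpos : 0 < η := by positivity
  have h2π : (0 : ℝ) < (2 * Real.pi) ^ 2 := by positivity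
  -- thresholds in `L`: grid convergence (H2) and Riemann sums, for the integers in `T`
  choose Lf hLf using fun n : ℤ => hconv n η hηpos
  have hR : ∀ n : ℤ, Tendsto (cornerRiemannSum (fun p => φ n (p + fun _ => Real.pi))) atTop (𝓝 (I n)) := fun n =>
    tendsto_cornerRiemannSum ((hφ n).comp (continuous_id.add continuous_const)).continuousOn
  have hR' : ∀ n : ℤ, ∃ L₂ : ℕ, ∀ L ≥ L₂, ‖cornerRiemannSum (fun p => φ n (p + fun _ => Real.pi)) L - I n‖ ≤
      (2 * Real.pi) ^ 2 * η := by
    intro n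
    obtain ⟨L₂, hL₂⟩ := Metric.tendsto_atTop.mp (hR n) ((2 * Real.pi) ^ 2 * η) (by positivity)
    exact ⟨L₂, fun L hL => by rw [← dist_eq_norm]; exact (hL₂ L hL).le⟩
  choose Lr hLr using hR'
  refine ⟨max (max L₀ 1) (max (T.sup Lf) (T.sup Lr)), fun L _ hL => ?_⟩
  have hLL₀ : L₀ ≤ L := le_trans (le_trans (le_max_left _ _) (le_max_left _ _)) hL
  have hLf' : ∀ n ∈ T, Lf n ≤ L := fun n hn =>
    le_trans (le_trans (Finset.le_sup hn) (le_max_left _ _)) (le_trans (le_max_right _ _) hL)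
  have hLr' : ∀ n ∈ T, Lr n ≤ L := fun n hn =>
    le_trans (le_trans (Finset.le_sup hn) (le_max_right _ _)) (le_trans (le_max_right _ _) hL)
  have hLpos : (0 : ℝ) < (L : ℝ) ^ 2 := by
    have : (0 : ℝ) < L := by exact_mod_cast Nat.pos_of_ne_zero (NeZero.ne L)
    positivity
  -- thresholds in `M`
  choose Mf hMf using fun n : {m // m ∈ T} => hLf n.1 L (hLf' n.1 n.2)
  refine ⟨max (max (Mstar L) (T.sup (fun n => n.natAbs) + 1)) (Finset.univ.sup Mf), fun M hM => ?_⟩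
  have hMs : Mstar L ≤ M := le_trans (le_trans (le_max_left _ _) (le_max_left _ _)) hM
  have hMT : ∀ n ∈ T, n.natAbs + 1 ≤ M := fun n hn => by
    have := Finset.le_sup (f := fun n : ℤ => n.natAbs) hn
    exact le_trans (by simpa using Nat.succ_le_succ this) (le_trans (le_trans (le_max_right _ _) (le_max_left _ _)) hM)
  have hMf' : ∀ (n : ℤ) (hn : n ∈ T), Mf ⟨n, hn⟩ ≤ M := fun n hn =>
    le_trans (Finset.le_sup (f := Mf) (Finset.mem_univ _)) (le_trans (le_max_right _ _) hM)
  -- the index of each `n ∈ T`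
  have hex : ∀ n : ℤ, n ∈ T → ∃ i : MatsubaraIdx M, matsubaraInt M i = n := fun n hn => by
    have := hMT n hn
    exact exists_matsubaraInt_eq_of_le_of_lt (by omega) (by omega)
  have hM1 : 0 < 2 * M := by
    have : 1 ≤ M := le_trans (le_trans (Nat.succ_le_succ (Nat.zero_le _)) (le_max_right _ _))
      (le_trans (le_max_left _ _) hM)
    omega
  haveI : Nonempty (MatsubaraIdx M) := ⟨⟨0, hM1⟩⟩
  choose! idx hidx using hex
  -- the row sums
  set G : MatsubaraIdx M → ℂ := fun i => ∑ q : TorusSite 2 L, f L M (i, q) with hG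
  set P : Finset (MatsubaraIdx M) := Finset.univ.filter fun i => matsubaraInt M i ∈ T with hP
  have htot : ∑ k : FreqMomentum L M, f L M k = ∑ i ∈ P, G i + ∑ i ∈ Finset.univ.filter (fun i => matsubaraInt M i ∉ T), G i := by
    rw [Fintype.sum_prod_type, ← Finset.sum_filter_add_sum_filter_not Finset.univ (fun i => matsubaraInt M i ∈ T)]
  -- HEAD: reindex by `n ∈ T`
  have hhead : ∑ i ∈ P, G i = ∑ n ∈ T, G (idx n) := by
    rw [← Finset.sum_fiberwise_of_maps_to (s := P) (t := T) (g := fun i => matsubaraInt M i)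
      (fun i hi => (Finset.mem_filter.mp hi).2)]
    refine Finset.sum_congr rfl fun n hn => ?_
    have hmem : idx n ∈ P.filter (fun i => matsubaraInt M i = n) := by
      simp only [hP, Finset.mem_filter, Finset.mem_univ, true_and, hidx n hn]
      exact ⟨hn, trivial⟩
    refine Finset.sum_eq_single_of_mem (idx n) hmem fun b hb hne => ?_
    exfalso
    apply hne
    apply matsubaraInt_injective M
    rw [(Finset.mem_filter.mp hb).2, hidx n hn]
  -- norms of quotients by positive reals
  have hnormdiv : ∀ (z : ℂ) {r : ℝ}, 0 < r → ‖z / (r : ℂ)‖ = ‖z‖ / r := fun z r hr => by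
    rw [norm_div, Complex.norm_real, Real.norm_of_nonneg hr.le]
  have hβL : 0 < β * (L : ℝ) ^ 2 := mul_pos hβ hLpos
  have hβπ : 0 < β * (2 * Real.pi) ^ 2 := mul_pos hβ h2π
  have hcardL : (Fintype.card (TorusSite 2 L) : ℝ) = (L : ℝ) ^ 2 := by
    rw [card_torusSite]; push_cast; ring
  -- HEAD: each `n ∈ T` contributes at most `2η/β`
  have hpiece : ∀ n ∈ T, ‖G (idx n) / ((β * (L : ℝ) ^ 2 : ℝ) : ℂ) - I n / ((β * (2 * Real.pi) ^ 2 : ℝ) : ℂ)‖ ≤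
      2 * η / β := by
    intro n hn
    set D : ℂ := ∑ q : TorusSite 2 L, (f L M (idx n, q) - φ n (latticeMomentum L q)) with hD
    set R : ℂ := cornerRiemannSum (fun p => φ n (p + fun _ => Real.pi)) L with hRdef
    have hsplit : G (idx n) = D + ∑ q : TorusSite 2 L, φ n (latticeMomentum L q) := by
      simp only [hG, hD, ← Finset.sum_add_distrib, sub_add_cancel]
    have hRiem : ∑ q : TorusSite 2 L, φ n (latticeMomentum L q) = (((L : ℝ) ^ 2 / (2 * Real.pi) ^ 2 : ℝ) : ℂ) * R := by
      have h1 := sum_latticeMomentum_eq_cornerRiemannSum (φ n) L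
      rw [← hRdef] at h1
      have h2 : ∑ q : TorusSite 2 L, φ n (latticeMomentum L q) =
          ((L : ℝ) ^ 2) • (((L : ℝ) ^ 2)⁻¹ • ∑ q : TorusSite 2 L, φ n (latticeMomentum L q)) := by
        rw [smul_smul, mul_inv_cancel₀ hLpos.ne', one_smul]
      rw [h2, h1, smul_smul, Complex.real_smul, div_eq_mul_inv]
    have hb1 : ‖D‖ ≤ (L : ℝ) ^ 2 * η := by
      calc ‖D‖ ≤ ∑ q : TorusSite 2 L, ‖f L M (idx n, q) - φ n (latticeMomentum L q)‖ := norm_sum_le _ _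
        _ ≤ ∑ _q : TorusSite 2 L, η := Finset.sum_le_sum fun q _ => hMf ⟨n, hn⟩ M (hMf' n hn) (idx n, q) (hidx n hn)
        _ = (L : ℝ) ^ 2 * η := by rw [Finset.sum_const, Finset.card_univ, nsmul_eq_mul, hcardL]
    have hb2 : ‖R - I n‖ ≤ (2 * Real.pi) ^ 2 * η := hLr n L (hLr' n hn)
    have halg : G (idx n) / ((β * (L : ℝ) ^ 2 : ℝ) : ℂ) - I n / ((β * (2 * Real.pi) ^ 2 : ℝ) : ℂ) =
        D / ((β * (L : ℝ) ^ 2 : ℝ) : ℂ) + (R - I n) / ((β * (2 * Real.pi) ^ 2 : ℝ) : ℂ) := by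
      rw [hsplit, hRiem]
      have hL0 : (L : ℂ) ≠ 0 := by exact_mod_cast (NeZero.ne L)
      have hβ0 : (β : ℂ) ≠ 0 := by exact_mod_cast hβ.ne'
      have hπ0 : (Real.pi : ℂ) ≠ 0 := by exact_mod_cast Real.pi_ne_zero
      push_cast
      field_simp
      ring
    rw [halg]
    calc ‖D / ((β * (L : ℝ) ^ 2 : ℝ) : ℂ) + (R - I n) / ((β * (2 * Real.pi) ^ 2 : ℝ) : ℂ)‖
        ≤ ‖D / ((β * (L : ℝ) ^ 2 : ℝ) : ℂ)‖ + ‖(R - I n) / ((β * (2 * Real.pi) ^ 2 : ℝ) : ℂ)‖ := norm_add_le _ _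
      _ = ‖D‖ / (β * (L : ℝ) ^ 2) + ‖R - I n‖ / (β * (2 * Real.pi) ^ 2) := by
          rw [hnormdiv _ hβL, hnormdiv _ hβπ]
      _ ≤ ((L : ℝ) ^ 2 * η) / (β * (L : ℝ) ^ 2) + ((2 * Real.pi) ^ 2 * η) / (β * (2 * Real.pi) ^ 2) := by
          gcongr
      _ = 2 * η / β := by
          have hLne : (L : ℝ) ≠ 0 := by exact_mod_cast (NeZero.ne L)
          field_simp
          ring
  -- TAIL of `f`
  set Pc : Finset (MatsubaraIdx M) := Finset.univ.filter fun i => matsubaraInt M i ∉ T with hPc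
  have htailf : ‖(∑ i ∈ Pc, G i) / ((β * (L : ℝ) ^ 2 : ℝ) : ℂ)‖ ≤ δ / β := by
    have hGi : ∀ i, ‖G i‖ ≤ (L : ℝ) ^ 2 * h (matsubaraInt M i) := by
      intro i
      calc ‖G i‖ ≤ ∑ q : TorusSite 2 L, ‖f L M (i, q)‖ := norm_sum_le _ _
        _ ≤ ∑ _q : TorusSite 2 L, C / (matsubaraFreq β M i) ^ 2 :=
            Finset.sum_le_sum fun q _ => hdom L hLL₀ M hMs (i, q)
        _ = (L : ℝ) ^ 2 * h (matsubaraInt M i) := by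
            rw [Finset.sum_const, Finset.card_univ, nsmul_eq_mul, hcardL,
              matsubaraFreq_eq_of_matsubaraInt_eq (β := β) (rfl : matsubaraInt M i = matsubaraInt M i)]
    have hsumle : ∑ i ∈ Pc, h (matsubaraInt M i) ≤ ∑' n : {m // m ∉ T}, h n := by
      rw [← Finset.sum_image (f := h) (fun i _ j _ hij => matsubaraInt_injective M hij)]
      refine sum_le_tsum_subtype_compl_of_disjoint hh0 hhsum T _ fun n hn => ?_
      obtain ⟨i, hi, rfl⟩ := Finset.mem_image.mp hn
      exact (Finset.mem_filter.mp hi).2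
    rw [hnormdiv _ hβL]
    calc ‖∑ i ∈ Pc, G i‖ / (β * (L : ℝ) ^ 2)
        ≤ (∑ i ∈ Pc, (L : ℝ) ^ 2 * h (matsubaraInt M i)) / (β * (L : ℝ) ^ 2) := by
          gcongr
          exact (norm_sum_le _ _).trans (Finset.sum_le_sum fun i _ => hGi i)
      _ = (∑ i ∈ Pc, h (matsubaraInt M i)) / β := by
          have hLne : (L : ℝ) ≠ 0 := by exact_mod_cast (NeZero.ne L)
          rw [← Finset.mul_sum]
          field_simp
      _ ≤ (∑' n : {m // m ∉ T}, h n) / β := by gcongr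
      _ ≤ δ / β := by gcongr
  -- TAIL of the limit series
  have htailS : ‖(∑' n : {m // m ∉ T}, I n) / ((β * (2 * Real.pi) ^ 2 : ℝ) : ℂ)‖ ≤ δ / β := by
    have hsub : Summable fun n : {m // m ∉ T} => ‖I n‖ := hIsum.norm.subtype _
    have h1 : ‖∑' n : {m // m ∉ T}, I n‖ ≤ ∑' n : {m // m ∉ T}, ‖I n‖ := norm_tsum_le_tsum_norm hsub
    have h2 : ∑' n : {m // m ∉ T}, ‖I n‖ ≤ ∑' n : {m // m ∉ T}, (2 * Real.pi) ^ 2 * h n :=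
      Summable.tsum_le_tsum (fun n => hIle n) hsub ((hhsum.mul_left _).subtype _)
    have h3 : ∑' n : {m // m ∉ T}, (2 * Real.pi) ^ 2 * h n = (2 * Real.pi) ^ 2 * ∑' n : {m // m ∉ T}, h n :=
      tsum_mul_left
    rw [hnormdiv _ hβπ]
    calc ‖∑' n : {m // m ∉ T}, I n‖ / (β * (2 * Real.pi) ^ 2)
        ≤ ((2 * Real.pi) ^ 2 * ∑' n : {m // m ∉ T}, h n) / (β * (2 * Real.pi) ^ 2) := by
          gcongr
          linarith
      _ = (∑' n : {m // m ∉ T}, h n) / β := by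
          field_simp
      _ ≤ δ / β := by gcongr
  -- assemble
  have hS : ∑' n : ℤ, I n = ∑ n ∈ T, I n + ∑' n : {m // m ∉ T}, I n := (hIsum.sum_add_tsum_subtype_compl T).symm
  have halg : (∑ k : FreqMomentum L M, f L M k) / ((β * (L : ℝ) ^ 2 : ℝ) : ℂ) -
      (∑' n : ℤ, I n) / ((β * (2 * Real.pi) ^ 2 : ℝ) : ℂ) =
      ∑ n ∈ T, (G (idx n) / ((β * (L : ℝ) ^ 2 : ℝ) : ℂ) - I n / ((β * (2 * Real.pi) ^ 2 : ℝ) : ℂ)) +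
        (∑ i ∈ Pc, G i) / ((β * (L : ℝ) ^ 2 : ℝ) : ℂ) -
        (∑' n : {m // m ∉ T}, I n) / ((β * (2 * Real.pi) ^ 2 : ℝ) : ℂ) := by
    rw [htot, hhead, hS]
    simp only [add_div, Finset.sum_sub_distrib, Finset.sum_div]
    ring
  have hcount : (T.card : ℝ) * (2 * η / β) ≤ ε / 2 := by
    have hc : (0 : ℝ) ≤ T.card := Nat.cast_nonneg _
    rw [hη]
    rw [show (T.card : ℝ) * (2 * (ε * β / (4 * ((T.card : ℝ) + 1))) / β) =
      ε / 2 * ((T.card : ℝ) / ((T.card : ℝ) + 1)) by field_simp; ring]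
    have : (T.card : ℝ) / ((T.card : ℝ) + 1) ≤ 1 := by
      rw [div_le_one (by positivity)]; linarith
    calc ε / 2 * ((T.card : ℝ) / ((T.card : ℝ) + 1)) ≤ ε / 2 * 1 := by gcongr
      _ = ε / 2 := mul_one _
  have hδβ : δ / β = ε / 4 := by rw [hδ]; field_simp
  rw [halg]
  calc ‖∑ n ∈ T, (G (idx n) / ((β * (L : ℝ) ^ 2 : ℝ) : ℂ) - I n / ((β * (2 * Real.pi) ^ 2 : ℝ) : ℂ)) +
        (∑ i ∈ Pc, G i) / ((β * (L : ℝ) ^ 2 : ℝ) : ℂ) -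
        (∑' n : {m // m ∉ T}, I n) / ((β * (2 * Real.pi) ^ 2 : ℝ) : ℂ)‖
      ≤ ‖∑ n ∈ T, (G (idx n) / ((β * (L : ℝ) ^ 2 : ℝ) : ℂ) - I n / ((β * (2 * Real.pi) ^ 2 : ℝ) : ℂ))‖ +
          ‖(∑ i ∈ Pc, G i) / ((β * (L : ℝ) ^ 2 : ℝ) : ℂ)‖ +
          ‖(∑' n : {m // m ∉ T}, I n) / ((β * (2 * Real.pi) ^ 2 : ℝ) : ℂ)‖ := norm_sub_le_of_le (norm_add_le _ _) le_rfl
    _ ≤ (∑ n ∈ T, (2 * η / β)) + δ / β + δ / β := by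
        gcongr
        · exact (norm_sum_le _ _).trans (Finset.sum_le_sum fun n hn => hpiece n hn)
    _ = (T.card : ℝ) * (2 * η / β) + δ / β + δ / β := by
        rw [Finset.sum_const, nsmul_eq_mul]
    _ ≤ ε / 2 + ε / 4 + ε / 4 := by rw [hδβ]; gcongr
    _ = ε := by ring

/-- **Cauchy form** (the quantifier shape of the stub `stub_asm_int`): under (H1)–(H2) the normalised double sums
`(βL²)⁻¹ Σ_{(ω,q)} f L M (ω,q)` are Cauchy in the iterated sense — for every `ε > 0` there is `L₁` such that for all
`L, L′ ≥ L₁` there is `M₁` with `‖(βL²)⁻¹Σ f L M − (βL′²)⁻¹Σ f L′ M′‖ ≤ ε` for all `M, M′ ≥ M₁`. -/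
theorem matsubaraRiemann_cauchy (hβ : 0 < β) (hφ : ∀ n, Continuous (φ n))
    (hdom : ∀ (L : ℕ) [NeZero L], L₀ ≤ L → ∀ M : ℕ, Mstar L ≤ M → ∀ k : FreqMomentum L M,
      ‖f L M k‖ ≤ C / (matsubaraFreq β M k.1) ^ 2)
    (hconv : ∀ (n : ℤ) (ε : ℝ), 0 < ε → ∃ L₁ : ℕ, ∀ (L : ℕ) [NeZero L], L₁ ≤ L → ∃ M₁ : ℕ, ∀ M : ℕ, M₁ ≤ M →
      ∀ k : FreqMomentum L M, matsubaraInt M k.1 = n → ‖f L M k - φ n (latticeMomentum L k.2)‖ ≤ ε)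
    (ε : ℝ) (hε : 0 < ε) :
    ∃ L₁ : ℕ, ∀ (L L' : ℕ) [NeZero L] [NeZero L'], L₁ ≤ L → L₁ ≤ L' →
      ∃ M₁ : ℕ, ∀ (M M' : ℕ), M₁ ≤ M → M₁ ≤ M' →
        ‖(∑ k : FreqMomentum L M, f L M k) / ((β * (L : ℝ) ^ 2 : ℝ) : ℂ) -
          (∑ k : FreqMomentum L' M', f L' M' k) / ((β * (L' : ℝ) ^ 2 : ℝ) : ℂ)‖ ≤ ε := by
  obtain ⟨_, hlim⟩ := matsubaraRiemann_doubleLimit f φ hβ hφ hdom hconv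
  obtain ⟨L₁, hL₁⟩ := hlim (ε / 2) (half_pos hε)
  refine ⟨L₁, fun L L' _ _ hL hL' => ?_⟩
  obtain ⟨M₁, hM₁⟩ := hL₁ L hL
  obtain ⟨M₁', hM₁'⟩ := hL₁ L' hL'
  refine ⟨max M₁ M₁', fun M M' hM hM' => ?_⟩
  have h1 := hM₁ M (le_trans (le_max_left _ _) hM)
  have h2 := hM₁' M' (le_trans (le_max_right _ _) hM')
  set S : ℂ := (∑' n : ℤ, ∫ p in brillouin 2, φ n (p + fun _ => Real.pi)) / ((β * (2 * Real.pi) ^ 2 : ℝ) : ℂ)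
  calc ‖(∑ k : FreqMomentum L M, f L M k) / ((β * (L : ℝ) ^ 2 : ℝ) : ℂ) -
        (∑ k : FreqMomentum L' M', f L' M' k) / ((β * (L' : ℝ) ^ 2 : ℝ) : ℂ)‖
      = ‖((∑ k : FreqMomentum L M, f L M k) / ((β * (L : ℝ) ^ 2 : ℝ) : ℂ) - S) -
          ((∑ k : FreqMomentum L' M', f L' M' k) / ((β * (L' : ℝ) ^ 2 : ℝ) : ℂ) - S)‖ := by
        rw [sub_sub_sub_cancel_right]
    _ ≤ ‖(∑ k : FreqMomentum L M, f L M k) / ((β * (L : ℝ) ^ 2 : ℝ) : ℂ) - S‖ +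
          ‖(∑ k : FreqMomentum L' M', f L' M' k) / ((β * (L' : ℝ) ^ 2 : ℝ) : ℂ) - S‖ := norm_sub_le _ _
    _ ≤ ε / 2 + ε / 2 := add_le_add h1 h2
    _ = ε := add_halves ε

end DoubleLimit

end Summit.HubbardSuperconductivity.HubbardSuperconductivity.Theorems.TwoPointAssembly

end
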